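import Literature.AlgebraicGeometry.PlaneCurves.HessePencilHessian
import HarnessLib

/-!
# The four triangles and the nine base points of the Hesse pencil (Artebani–Dolgachev §2)

Topic `Literature/AlgebraicGeometry/PlaneCurves`, namespace `Literature.AlgebraicGeometry.PlaneCurves`.
Lane `lit-hodgefound`, seat `lit-hodgefound-p37`, row g17-#9; a one-file sequel of
`HessePencilWeierstrassForm` (g16-#4) and `HessePencilHessian` (g17-#8: `hesse_eval`,
`hesse_eval_pderiv`; the members `μ³ ≠ 1` are smooth, the members `μ³ = 1` singular; the flexes of
a smooth member are its points on `XYZ = 0`).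
Everything here is PROVED (polynomial identities); no definition, no named fact.

Source followed — M. Artebani, I. Dolgachev, *The Hesse pencil of plane cubic curves*,
L'Enseignement Math. (2) 55 (2009) 235–273, §2 [arXiv:math/0611590, held `paper:arxiv-math_0611590`
p0004 L16–L25, p0005 L35–L48, L58–L65]:

> Since the pencil is generated by the Fermat cubic `E₀` and its Hessian, its nine base points
> are in the Hesse configuration. In fact, they are the inflection points of any smooth curve in
> the pencil. In coordinates they are: `p₀ = (0, 1, −1)`, `p₁ = (0, 1, −ε)`, `p₂ = (0, 1, −ε²)`,
> `p₃ = (1, 0, −1)`, `p₄ = (1, 0, −ε²)`, `p₅ = (1, 0, −ε)`, `p₆ = (1, −1, 0)`, `p₇ = (1, −ε, 0)`,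
> `p₈ = (1, −ε², 0)`, where `ε` denotes a primitive third root of `1`. […]
> There are four singular members in the Hesse pencil, each one is the union of three lines:
> `E_∞ : xyz = 0`, `E_{−3} : (x + y + z)(x + εy + ε²z)(x + ε²y + εz) = 0`,
> `E_{−3ε} : (x + εy + z)(x + ε²y + ε²z)(x + y + εz) = 0`,
> `E_{−3ε²} : (x + ε²y + z)(x + εy + εz)(x + y + ε²z) = 0`.
> We will call these singular members the triangles […] The singular points of the triangles
> will be called the vertices of the triangles. They are `v₀ = (1, 0, 0)`, […] `v₃ = (1, 1, 1)`,
> `v₄ = (1, ε, ε²)`, `v₅ = (1, ε², ε)`, […]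
> (Remark 2.1) The Hesse pencil (…) in characteristic `3` has two singular members: `(x + y + z)³ = 0`
> and `xyz = 0`.

## Dictionary

* The pencil member `E_λ = x³ + y³ + z³ + λxyz` at `λ = −3μ` is written `H_μ = X³ + Y³ + Z³ − 3μXYZ`
  (local notation `𝐇[μ]`, as in `HessePencilWeierstrassForm`); so `E_{−3} = H_1`, `E_{−3ε} = H_ε`,
  `E_{−3ε²} = H_{ε²}`, and `E_∞ = XYZ` is not of the form `H_μ`.
* "a primitive third root of `1`" is an `ω ∈ K` with `ω² + ω + 1 = 0` (then `ω³ = 1`; no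
  assumption on the characteristic is needed for the identities — in characteristic `3`, `ω = 1`).
* A base point of the pencil is a common zero of `XYZ` and `X³ + Y³ + Z³` (hence of every member);
  points of `ℙ²` are non-zero vectors up to a scalar `c ≠ 0`.

## What is here

* §1 `omega_pow_three` (`ω³ = 1`), `pow_three_sub_one_eq_prod` (`μ³ − 1 = (μ − 1)(μ − ω)(μ − ω²)`),
  `pow_three_eq_one_iff_of_omega` (the parameters of the three triangles `H_μ`: `μ³ = 1` iff
  `μ ∈ {1, ω, ω²}`), `cube_add_cube_eq_prod` (`u³ + v³ = (u + v)(u + ωv)(u + ω²v)`).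
* §2 **The triangles**, as identities in `K[X, Y, Z]`: `hesse_one_eq_prod`
  (`E_{−3} = H_1 = (X + Y + Z)(X + ωY + ω²Z)(X + ω²Y + ωZ)`), `hesse_omega_eq_prod` (`E_{−3ε}` as
  printed), `hesse_omega_sq_eq_prod` (`E_{−3ε²}` as printed), the uniform
  `hesse_eq_prod_of_pow_three_eq_one` (`μ³ = 1`:
  `H_μ = (X + Y + μZ)(X + ωY + ω²μZ)(X + ω²Y + ωμZ)`), and Remark 2.1's characteristic-`3`
  degeneration `hesse_of_three_eq_zero` (`3 = 0`: `H_μ = (X + Y + Z)³` for every `μ`).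
* §3 **The nine base points**: `hesse_nine_basePoints` — the points `c·(0, 1, −ω^k)`,
  `c·(1, 0, −ω^k)`, `c·(1, −ω^k, 0)` lie on `XYZ = 0` and on `X³ + Y³ + Z³ = 0` (hence on every
  `H_μ`); `hesse_basePoint_cases` — conversely every non-zero common zero of `XYZ` and
  `X³ + Y³ + Z³` is `c·` one of these nine (`c ≠ 0`, `k < 3`).  (Over `ℂ` with `ZMod 3` indices
  the nine points appear in the seat's Mumford file `MumfordHeisenbergHessePencilFlexes`, row
  Q1531, `basePoint_cases` / `inflexion_iff_mem_nine`; here over any field containing `ω`.)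
* §4 **"they are the inflection points of any smooth curve in the pencil"**:
  `hesse_nine_basePoints_flex` — for `2, 3 ≠ 0` and `μ³ ≠ 1` the nine points are flexes of `H_μ`
  (`HessePencilHessian.hesse_flex_iff`, g17-#8); and **the vertices** of the triangle `E_{−3} = H_1`:
  `hesse_one_vertices` — `v₃ = (1, 1, 1)`, `v₄ = (1, ω, ω²)`, `v₅ = (1, ω², ω)` are singular points
  of `H_1` ("The singular points of the triangles will be called the vertices").

NOT here: the vertices of the other three triangles (`v₀, v₁, v₂` of `XYZ`, `v₆, …, v₁₁`), the
incidences "each side of a triangle contains 3 base points", the `3`-level structure `α`, Kodaira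
type `I₃`.

## References
* [ArtebaniDolgachev2009] M. Artebani, I. Dolgachev, *The Hesse pencil of plane cubic curves*,
  Enseign. Math. (2) 55 (2009) 235–273, §2 (the base points `p₀, …, p₈`, the four triangles,
  Remark 2.1).
* [Mumford1966EquationsI] D. Mumford, *On the equations defining abelian varieties I*, Invent.
  Math. 1 (1966), §5 Case b) (`μ ≠ 1, ω, ω², ∞`).
-/

set_option autoImplicit false

open MvPolynomial Matrix

namespace Literature.AlgebraicGeometry.PlaneCurves

universe u

/-- The Hesse cubic `H_μ = X³ + Y³ + Z³ − 3μXYZ` (local notation as in the statements of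
`HessePencilWeierstrassForm`, no definition). -/
local notation3 "𝐇[" μ "]" =>
  (X 0 ^ 3 + X 1 ^ 3 + X 2 ^ 3 - C (3 * μ) * (X 0 * X 1 * X 2) : MvPolynomial (Fin 3) _)

section Triangles

variable {K : Type u} [Field K]

/-! ## §1 A primitive cube root of unity `ω`: `ω² + ω + 1 = 0` -/

/-- A root `ω` of `ω² + ω + 1` is a cube root of unity: `ω³ = 1` ("`ε` denotes a primitive third
root of `1`"). [cite: ArtebaniDolgachev2009, §2 (the base points, "`ε` a primitive third root of 1")] -/
theorem omega_pow_three {ω : K} (hω : ω ^ 2 + ω + 1 = 0) : ω ^ 3 = 1 := by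
  linear_combination (ω - 1) * hω

/-- `μ³ − 1 = (μ − 1)(μ − ω)(μ − ω²)` for `ω² + ω + 1 = 0`.
[cite: ArtebaniDolgachev2009, §2 (the singular members `E_{−3}, E_{−3ε}, E_{−3ε²}`)] -/
theorem pow_three_sub_one_eq_prod {ω : K} (hω : ω ^ 2 + ω + 1 = 0) (μ : K) :
    μ ^ 3 - 1 = (μ - 1) * (μ - ω) * (μ - ω ^ 2) := by
  linear_combination (μ ^ 2 - ω * μ + ω - 1) * hω

/-- **The parameters of the three triangles `H_μ`**: for `ω² + ω + 1 = 0`, `μ³ = 1` iff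
`μ ∈ {1, ω, ω²}` — i.e. (`λ = −3μ`) `λ ∈ {−3, −3ε, −3ε²}`, the source's `E_{−3}, E_{−3ε}, E_{−3ε²}`
(Mumford: "`μ ≠ 1, ω, ω²`"). [cite: ArtebaniDolgachev2009, §2 (the four singular members)]
[cite: Mumford1966EquationsI, §5 Case b)] -/
theorem pow_three_eq_one_iff_of_omega {ω : K} (hω : ω ^ 2 + ω + 1 = 0) (μ : K) :
    μ ^ 3 = 1 ↔ μ = 1 ∨ μ = ω ∨ μ = ω ^ 2 := by
  rw [← sub_eq_zero, pow_three_sub_one_eq_prod hω, mul_eq_zero, mul_eq_zero, sub_eq_zero,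
    sub_eq_zero, sub_eq_zero, or_assoc]

/-- `u³ + v³ = (u + v)(u + ωv)(u + ω²v)` for `ω² + ω + 1 = 0` (the restriction of
`X³ + Y³ + Z³` to a side of the triangle `XYZ = 0`). [cite: ArtebaniDolgachev2009, §2 (the base
points `(0, 1, −ε^k)`, …)] -/
theorem cube_add_cube_eq_prod {ω : K} (hω : ω ^ 2 + ω + 1 = 0) (u v : K) :
    u ^ 3 + v ^ 3 = (u + v) * (u + ω * v) * (u + ω ^ 2 * v) := by
  linear_combination (-((u + v) * (u * v + v ^ 2 * (ω - 1)))) * hω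

/-! ## §2 The four triangles -/

/-- **`E_{−3} : (x + y + z)(x + εy + ε²z)(x + ε²y + εz) = 0`** — the member `H_1 = X³ + Y³ + Z³ −
3XYZ` is the triangle `(X + Y + Z)(X + ωY + ω²Z)(X + ω²Y + ωZ)`, identically in `K[X, Y, Z]`, for
`ω² + ω + 1 = 0`. [cite: ArtebaniDolgachev2009, §2 (the four singular members)] -/
theorem hesse_one_eq_prod {ω : K} (hω : ω ^ 2 + ω + 1 = 0) :
    (𝐇[(1 : K)] : MvPolynomial (Fin 3) K) =
      (X 0 + X 1 + X 2) * (X 0 + C ω * X 1 + C ω ^ 2 * X 2) * (X 0 + C ω ^ 2 * X 1 + C ω * X 2) := by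
  have hr : (C ω : MvPolynomial (Fin 3) K) ^ 2 + C ω + 1 = 0 := by
    rw [← C_pow, ← C_add, ← C_1, ← C_add, hω, C_0]
  rw [mul_one, show (C 3 : MvPolynomial (Fin 3) K) = 3 from map_ofNat C 3]
  linear_combination (-((X 0 + X 1 + X 2) * ((X 0 * X 1 + X 0 * X 2) + (X 1 ^ 2 + X 2 ^ 2) * (C ω - 1) +
    X 1 * X 2 * (C ω ^ 2 - C ω + 1)))) * hr

/-- **Every member with `μ³ = 1` is a triangle**: `H_μ = (X + Y + μZ)(X + ωY + ω²μZ)(X + ω²Y + ωμZ)`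
identically, for `ω² + ω + 1 = 0` and `μ³ = 1` (substitute `Z ↦ μZ` in `hesse_one_eq_prod`).
[cite: ArtebaniDolgachev2009, §2 ("There are four singular members in the Hesse pencil, each one
is the union of three lines")] -/
theorem hesse_eq_prod_of_pow_three_eq_one {ω : K} (hω : ω ^ 2 + ω + 1 = 0) {μ : K} (hμ : μ ^ 3 = 1) :
    (𝐇[μ] : MvPolynomial (Fin 3) K) =
      (X 0 + X 1 + C μ * X 2) * (X 0 + C ω * X 1 + C ω ^ 2 * (C μ * X 2)) *
        (X 0 + C ω ^ 2 * X 1 + C ω * (C μ * X 2)) := by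
  have hr : (C ω : MvPolynomial (Fin 3) K) ^ 2 + C ω + 1 = 0 := by
    rw [← C_pow, ← C_add, ← C_1, ← C_add, hω, C_0]
  have hm : (C μ : MvPolynomial (Fin 3) K) ^ 3 = 1 := by rw [← C_pow, hμ, C_1]
  rw [show (C (3 * μ) : MvPolynomial (Fin 3) K) = 3 * C μ by rw [map_mul, map_ofNat]]
  linear_combination (-((X 0 + X 1 + C μ * X 2) * ((X 0 * X 1 + X 0 * (C μ * X 2)) +
      (X 1 ^ 2 + (C μ * X 2) ^ 2) * (C ω - 1) + X 1 * (C μ * X 2) * (C ω ^ 2 - C ω + 1)))) * hr +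
    (-(X 2 ^ 3)) * hm

/-- **`E_{−3ε} : (x + εy + z)(x + ε²y + ε²z)(x + y + εz) = 0`**, as printed: the member `H_ω` is
this product of three lines (`ω² + ω + 1 = 0`). [cite: ArtebaniDolgachev2009, §2 (the four
singular members)] -/
theorem hesse_omega_eq_prod {ω : K} (hω : ω ^ 2 + ω + 1 = 0) :
    (𝐇[ω] : MvPolynomial (Fin 3) K) =
      (X 0 + C ω * X 1 + X 2) * (X 0 + C ω ^ 2 * X 1 + C ω ^ 2 * X 2) * (X 0 + X 1 + C ω * X 2) := by
  have h3 : (C ω : MvPolynomial (Fin 3) K) ^ 3 = 1 := by rw [← C_pow, omega_pow_three hω, C_1]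
  rw [hesse_eq_prod_of_pow_three_eq_one hω (omega_pow_three hω)]
  linear_combination ((X 0 + X 1 + C ω * X 2) * (X 0 + C ω ^ 2 * X 1 + C ω ^ 2 * X 2) * X 2) * h3

/-- **`E_{−3ε²} : (x + ε²y + z)(x + εy + εz)(x + y + ε²z) = 0`**, as printed: the member `H_{ω²}`
is this product of three lines (`ω² + ω + 1 = 0`). [cite: ArtebaniDolgachev2009, §2 (the four
singular members)] -/
theorem hesse_omega_sq_eq_prod {ω : K} (hω : ω ^ 2 + ω + 1 = 0) :
    (𝐇[ω ^ 2] : MvPolynomial (Fin 3) K) =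
      (X 0 + C ω ^ 2 * X 1 + X 2) * (X 0 + C ω * X 1 + C ω * X 2) * (X 0 + X 1 + C ω ^ 2 * X 2) := by
  have h3 : (C ω : MvPolynomial (Fin 3) K) ^ 3 = 1 := by rw [← C_pow, omega_pow_three hω, C_1]
  have hμ : (ω ^ 2) ^ 3 = (1 : K) := by rw [← pow_mul, mul_comm, pow_mul, omega_pow_three hω, one_pow]
  rw [hesse_eq_prod_of_pow_three_eq_one hω hμ, C_pow]
  linear_combination ((X 0 + X 1 + C ω ^ 2 * X 2) * X 2 *
      ((X 0 + C ω * X 1 + C ω * X 2) + C ω * (X 0 + C ω ^ 2 * X 1 + X 2) +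
        C ω * (C ω ^ 3 - 1) * X 2)) * h3

/-- **Remark 2.1, characteristic `3`: the singular member `(x + y + z)³ = 0`** — if `3 = 0` in
`K` then `H_μ = X³ + Y³ + Z³ = (X + Y + Z)³` for every `μ` (in this parametrisation every `H_μ`
degenerates; the source's characteristic-`3` pencil is `xyz + t(x + y + z)³`).
[cite: ArtebaniDolgachev2009, §2, Remark 2.1] -/
theorem hesse_of_three_eq_zero (h3 : (3 : K) = 0) (μ : K) :
    (𝐇[μ] : MvPolynomial (Fin 3) K) = (X 0 + X 1 + X 2) ^ 3 := by
  have h3' : (3 : MvPolynomial (Fin 3) K) = 0 := by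
    rw [← map_ofNat C 3, show (OfNat.ofNat 3 : K) = 0 from h3, C_0]
  rw [show (C (3 * μ) : MvPolynomial (Fin 3) K) = 0 by rw [h3, zero_mul, C_0], zero_mul, sub_zero]
  linear_combination (-(X 0 ^ 2 * X 1 + X 0 ^ 2 * X 2 + X 1 ^ 2 * X 0 + X 1 ^ 2 * X 2 + X 2 ^ 2 * X 0 +
    X 2 ^ 2 * X 1 + 2 * (X 0 * X 1 * X 2))) * h3'

/-! ## §3 The nine base points -/

/-- **The nine base points `p₀, …, p₈`**: for `ω² + ω + 1 = 0`, every `k` and every scalar `c`,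
the points `c·(0, 1, −ω^k)`, `c·(1, 0, −ω^k)`, `c·(1, −ω^k, 0)` lie on `XYZ = 0` and on
`X³ + Y³ + Z³ = 0` — hence on every member `t₀(X³ + Y³ + Z³) + t₁XYZ` of the pencil.
[cite: ArtebaniDolgachev2009, §2 (the base points in coordinates)] -/
theorem hesse_nine_basePoints {ω : K} (hω : ω ^ 2 + ω + 1 = 0) {k : ℕ} (c : K) :
    (∀ q ∈ [c • ![0, 1, -ω ^ k], c • ![1, 0, -ω ^ k], c • ![1, -ω ^ k, 0]],
      (q : Fin 3 → K) 0 * q 1 * q 2 = 0 ∧ q 0 ^ 3 + q 1 ^ 3 + q 2 ^ 3 = 0) := by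
  have hk : (ω ^ k) ^ 3 = 1 := by
    rw [← pow_mul, mul_comm, pow_mul, omega_pow_three hω, one_pow]
  intro q hq
  simp only [List.mem_cons, List.not_mem_nil, or_false] at hq
  rcases hq with rfl | rfl | rfl
  · refine ⟨by simp, ?_⟩
    simp; linear_combination (-(c ^ 3)) * hk
  · refine ⟨by simp, ?_⟩
    simp; linear_combination (-(c ^ 3)) * hk
  · refine ⟨by simp, ?_⟩
    simp; linear_combination (-(c ^ 3)) * hk

/-- **The base points are exactly the nine**: over a field containing `ω` with `ω² + ω + 1 = 0`, a
non-zero common zero `p` of `XYZ` and `X³ + Y³ + Z³` is `c·(0, 1, −ω^k)`, `c·(1, 0, −ω^k)` or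
`c·(1, −ω^k, 0)` for some `c ≠ 0` and `k < 3` (one coordinate vanishes, and on that side
`u³ + v³ = (u + v)(u + ωv)(u + ω²v)`).  (Over `ℂ`: Q1531
`MumfordHeisenbergHessePencilFlexes.basePoint_cases`.)
[cite: ArtebaniDolgachev2009, §2 (the base points in coordinates)] -/
theorem hesse_basePoint_cases {ω : K} (hω : ω ^ 2 + ω + 1 = 0) {p : Fin 3 → K} (hp0 : p ≠ 0)
    (hπ : p 0 * p 1 * p 2 = 0) (hS : p 0 ^ 3 + p 1 ^ 3 + p 2 ^ 3 = 0) :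
    ∃ (c : K) (k : ℕ), c ≠ 0 ∧ k < 3 ∧
      (p = c • ![0, 1, -ω ^ k] ∨ p = c • ![1, 0, -ω ^ k] ∨ p = c • ![1, -ω ^ k, 0]) := by
  have h13 := omega_pow_three hω
  -- which coordinate vanishes
  rcases mul_eq_zero.1 hπ with h01 | h2
  · rcases mul_eq_zero.1 h01 with h0 | h1
    · -- `p₀ = 0`: `p₁³ + p₂³ = 0`
      have hne : p 1 ≠ 0 := by
        intro h1
        apply hp0
        have h2 : p 2 = 0 := (pow_eq_zero_iff three_ne_zero).1 (by
          rw [h0, h1] at hS; simpa using hS)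
        funext i; fin_cases i <;> assumption
      have hf : (p 1 + p 2) * (p 1 + ω * p 2) * (p 1 + ω ^ 2 * p 2) = 0 := by
        rw [← cube_add_cube_eq_prod hω]; rw [h0] at hS; simpa using hS
      rcases mul_eq_zero.1 hf with hf | hf
      · rcases mul_eq_zero.1 hf with hf | hf
        · refine ⟨p 1, 0, hne, by norm_num, Or.inl ?_⟩
          funext i; fin_cases i
          · simp [h0]
          · simp
          · simp; linear_combination hf
        · refine ⟨p 1, 2, hne, by norm_num, Or.inl ?_⟩
          funext i; fin_cases i
          · simp [h0]
          · simp
          · simp; linear_combination ω ^ 2 * hf - p 2 * (ω - 1) * hω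
      · refine ⟨p 1, 1, hne, by norm_num, Or.inl ?_⟩
        funext i; fin_cases i
        · simp [h0]
        · simp
        · simp; linear_combination ω * hf - p 2 * h13 + 0 * hω
    · -- `p₁ = 0`: `p₀³ + p₂³ = 0`
      have hne : p 0 ≠ 0 := by
        intro h0
        apply hp0
        have h2 : p 2 = 0 := (pow_eq_zero_iff three_ne_zero).1 (by
          rw [h0, h1] at hS; simpa using hS)
        funext i; fin_cases i <;> assumption
      have hf : (p 0 + p 2) * (p 0 + ω * p 2) * (p 0 + ω ^ 2 * p 2) = 0 := by
        rw [← cube_add_cube_eq_prod hω]; rw [h1] at hS; simpa using hS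
      rcases mul_eq_zero.1 hf with hf | hf
      · rcases mul_eq_zero.1 hf with hf | hf
        · refine ⟨p 0, 0, hne, by norm_num, Or.inr (Or.inl ?_)⟩
          funext i; fin_cases i
          · simp
          · simp [h1]
          · simp; linear_combination hf
        · refine ⟨p 0, 2, hne, by norm_num, Or.inr (Or.inl ?_)⟩
          funext i; fin_cases i
          · simp
          · simp [h1]
          · simp; linear_combination ω ^ 2 * hf - p 2 * (ω - 1) * hω
      · refine ⟨p 0, 1, hne, by norm_num, Or.inr (Or.inl ?_)⟩
        funext i; fin_cases i
        · simp
        · simp [h1]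
        · simp; linear_combination ω * hf - p 2 * h13
  · -- `p₂ = 0`: `p₀³ + p₁³ = 0`
    have hne : p 0 ≠ 0 := by
      intro h0
      apply hp0
      have h1 : p 1 = 0 := (pow_eq_zero_iff three_ne_zero).1 (by
        rw [h0, h2] at hS; simpa using hS)
      funext i; fin_cases i <;> assumption
    have hf : (p 0 + p 1) * (p 0 + ω * p 1) * (p 0 + ω ^ 2 * p 1) = 0 := by
      rw [← cube_add_cube_eq_prod hω]; rw [h2] at hS; simpa using hS
    rcases mul_eq_zero.1 hf with hf | hf
    · rcases mul_eq_zero.1 hf with hf | hf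
      · refine ⟨p 0, 0, hne, by norm_num, Or.inr (Or.inr ?_)⟩
        funext i; fin_cases i
        · simp
        · simp; linear_combination hf
        · simp [h2]
      · refine ⟨p 0, 2, hne, by norm_num, Or.inr (Or.inr ?_)⟩
        funext i; fin_cases i
        · simp
        · simp; linear_combination ω ^ 2 * hf - p 1 * (ω - 1) * hω
        · simp [h2]
    · refine ⟨p 0, 1, hne, by norm_num, Or.inr (Or.inr ?_)⟩
      funext i; fin_cases i
      · simp
      · simp; linear_combination ω * hf - p 1 * h13
      · simp [h2]

/-! ## §4 With the Hessian file: the base points are the flexes; the vertices -/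

/-- **"they are the inflection points of any smooth curve in the pencil"**: over a field with
`2 ≠ 0`, `3 ≠ 0` and `ω² + ω + 1 = 0`, for a smooth member `H_μ` (`μ³ ≠ 1`), each of the nine base
points `c·(0, 1, −ω^k)`, `c·(1, 0, −ω^k)`, `c·(1, −ω^k, 0)` (`c ≠ 0`) is a flex of `H_μ`: a
non-zero point of the curve with `∇H_μ ≠ 0` at which every tangent line meets `H_μ` to order `≥ 3`
(`HessePencilHessian.hesse_flex_iff`). [cite: ArtebaniDolgachev2009, §2 (the base points are the
inflection points of any smooth curve in the pencil)] -/
theorem hesse_nine_basePoints_flex (h2 : (2 : K) ≠ 0) (h3 : (3 : K) ≠ 0) {ω : K}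
    (hω : ω ^ 2 + ω + 1 = 0) {μ : K} (hμ : μ ^ 3 ≠ 1) {k : ℕ} {c : K} (hc : c ≠ 0) :
    ∀ q ∈ [c • ![0, 1, -ω ^ k], c • ![1, 0, -ω ^ k], c • ![1, -ω ^ k, 0]],
      (q : Fin 3 → K) ≠ 0 ∧ eval q 𝐇[μ] = 0 ∧ (fun i => eval q (pderiv i 𝐇[μ])) ≠ 0 ∧
        ∀ v, (fun i => eval q (pderiv i 𝐇[μ])) ⬝ᵥ v = 0 → LinearIndependent K ![q, v] →
          Polynomial.X ^ 3 ∣ Literature.AlgebraicGeometry.HyperbolicPolynomials.linePoly 𝐇[μ] q v := by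
  intro q hq
  obtain ⟨hπ, hS⟩ := hesse_nine_basePoints hω c q hq
  have hq0 : q ≠ 0 := by
    simp only [List.mem_cons, List.not_mem_nil, or_false] at hq
    rcases hq with rfl | rfl | rfl
    · intro e; simpa [hc] using congrFun e 1
    · intro e; simpa [hc] using congrFun e 0
    · intro e; simpa [hc] using congrFun e 0
  have hqH : eval q 𝐇[μ] = 0 := by rw [hesse_eval, hS, hπ]; ring
  exact ⟨hq0, hqH, hesse_grad_ne_zero h3 hμ hq0, (hesse_flex_iff h2 h3 hμ hq0 hqH).2 hπ⟩

/-- **The vertices of the triangle `E_{−3} = H_1`**: `v₃ = (1, 1, 1)`, `v₄ = (1, ω, ω²)`,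
`v₅ = (1, ω², ω)` lie on `H_1` and `∇H_1` vanishes there ("The singular points of the triangles
will be called the vertices of the triangles"), over any field with `ω² + ω + 1 = 0`.
[cite: ArtebaniDolgachev2009, §2 (the vertices `v₀, …, v₁₁`)] -/
theorem hesse_one_vertices {ω : K} (hω : ω ^ 2 + ω + 1 = 0) :
    ∀ v ∈ [![(1 : K), 1, 1], ![1, ω, ω ^ 2], ![1, ω ^ 2, ω]],
      eval v 𝐇[(1 : K)] = 0 ∧ (fun i => eval v (pderiv i 𝐇[(1 : K)])) = 0 := by
  have h13 := omega_pow_three hω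
  intro v hv
  simp only [List.mem_cons, List.not_mem_nil, or_false] at hv
  rcases hv with rfl | rfl | rfl
  · rw [hesse_eval, hesse_eval_pderiv]
    exact ⟨by simp; ring, by funext i; fin_cases i <;> simp⟩
  · rw [hesse_eval, hesse_eval_pderiv]
    refine ⟨?_, ?_⟩
    · simp; linear_combination (ω ^ 3 - 1) * h13
    · funext i; fin_cases i
      · simp; linear_combination (-3 : K) * h13
      · simp
      · simp; linear_combination (3 * ω) * h13
  · rw [hesse_eval, hesse_eval_pderiv]
    refine ⟨?_, ?_⟩
    · simp; linear_combination (ω ^ 3 - 1) * h13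
    · funext i; fin_cases i
      · simp; linear_combination (-3 : K) * h13
      · simp; linear_combination (3 * ω) * h13
      · simp

end Triangles

end Literature.AlgebraicGeometry.PlaneCurves
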